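import Mathlib
import Summits.Ventures.PercRepro2.HCov
import Summits.Ventures.PercRepro2.BHKAvoid
import Summits.Ventures.PercRepro2.ExploreA3
import Summits.Ventures.PercRepro2.RootLeafUSigns
import Summits.Ventures.PercRepro2.RootLeafUHalf
import Summits.Ventures.PercRepro2.RootLeafUOu
import Summits.Ventures.PercRepro2.RootLeafUTowerBHK
import Summits.Ventures.PercRepro2.RootLeafUClaimI

/-!
# The `o ∈ K` half of the second root-leaf coefficient: its o-free core VANISHES, the exact master formula
`t′·T2oK = Ee·E1K + (κ − α)·δK + 2β·B1K − 2β·B2K`, and the reduction `0 ≤ T2oK ⟸ C2 ≥ 0 ∧ C3 ≥ 0` for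
EVERY instance (blind cell PercRepro2, p4 g24; S3 (G4-u), proofs/P4-G24-OPOCKETL-MASTER.md §10)

With `T′ = Q ∩ {u ↔ c}` (`TEvent ends a₂ u c`), `t′ = P(T′)`, `R′ = PD ⊔ T′ = {a₂ ↮ u, a₂ ↮ c}` (`avoidAll ends a₂ {u, c}`),
`W′ = P(R′) = D + t′`, `oK = {a₂ ↔ o}`, `e0 = P(a₂ ↮ c, a₂ ↔ o)`, and `T2oK` (RootLeafUHalf):

* **`OK_eq_zero`**: `T2oK(o := a₂) = Ee·d0 + (κ − α)·D − 2α·t′ + 2β·P(T′,bK) − 2β·P(R′,bL) = 0` — the K side has no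
  o-free core (a `ring` identity after `Ee_eq`-type unfolding and the splits `Q = PD ⊔ T ⊔ T′`, `gap = P(Q,bK) − P(Q,bL)`);
* **`tp_mul_T2oK_eq`**: `t′·T2oK = Ee·E1K + (κ − α)·δK + 2β·B1K − 2β·B2K` with `E1K = t′·e0 − P(T′,oK)·d0`,
  `δK = t′·P(PD,oK) − D·P(T′,oK)`, `B1K = t′·P(T′,oK,bK) − P(T′,oK)·P(T′,bK)`, `B2K = t′·P(R′,oK,bL) − P(T′,oK)·P(R′,bL)`
  (the mirror of the L side's master identity, the e0-term in place of `A·δ`'s first half);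
* the signs: `kappa_sub_alpha_nonneg` (`κ − α = 2(hb·t′ − P(T′,bK)) + 2P(PD,bL) + 2P(T′,bL)`, the tower bound `prob_Tp_bK_le`),
  `deltaK_nonneg` (BHK06 1.4 with `s = a₂`, `X = {u, c}`: the mirror of `ToL_mul_D_le`), **`E1K_nonneg`** (explore
  `K = C_{a₂}` on `{a₂ ↮ c}`; the functional BHK 1.3 `bhk_induced` with `F₁ = 1_{o ∈ K}`, `F₂ = 1 − 1_{u ∉ K}·P_{G∖K}(c ∈ C_u)`),
  `B2K_mul_W_le` (`W′·B2K ≤ P(R′,bL)·δK`, BHK06 1.4 on `R′`);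
* **`T2oK_nonneg_of_C2_C3`**: `0 ≤ C2 → 0 ≤ C3 → 0 ≤ T2oK` for every finite graph and weight vector, where
  `C2 = Ee·W′·E1K + δK·(W′·(κ − α) − 2β·P(R′,bL)) + 2β·W′·B1K` and `C3 = Ee·e0 + (κ − α)·P(PD,oK) − 2β·P(PD,oK,bL)` (the
  value of `T2oK` when `t′ = 0`): `W′·t′·T2oK = C2 + 2β·(P(R′,bL)·δK − W′·B2K) ≥ 0`, so `T2oK ≥ 0` when `t′ > 0`; when
  `t′ = 0` the `T′`-masses vanish and `T2oK = C3`.  Both `C2 ≥ 0` and `C3 ≥ 0` are census-true on every instance tested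
  (0 / 1,900 general, 0 / 700 oc-pocket) and are the named open claims of the K side; `B1K` alone can be negative.
-/

namespace Summit.Ventures.PercRepro2

open UnionCluster CovForm

namespace RootLeafU

namespace KMaster

variable {V : Type*} {E : Type*} [Fintype E] [DecidableEq E] [Fintype V] [DecidableEq V]
  {R : Type*} [Field R] [LinearOrder R] [IsStrictOrderedRing R]

variable (p : E → R) (ends : E → Sym2 V) (o a₂ c b u : V)

omit [Fintype V] in
/-- **The o-free core of the `o ∈ K` half vanishes**: `T2oK(o := a₂) = 0`. -/
theorem OK_eq_zero : (Ee p ends a₂ c b u * prob p (avoidAll ends a₂ {c}) + ((prob p Set.univ * EQb3 p ends u a₂ c b + prob p Set.univ * PDb p ends u a₂ c b + prob p (connEvent ends a₂ b) * EQ3 p ends u a₂ c + prob p (connEvent ends a₂ b) * prob p (avoidAll ends a₂ {u}) - (prob p Set.univ - prob p (avoidAll ends a₂ {c})) * gap p ends u a₂ b) - (prob p (PDEvent ends u a₂ c) * prob p (connEvent ends a₂ b) + prob p (avoidAll ends a₂ {c}) * gap p ends u a₂ b)) * prob p (PDEvent ends u a₂ c) - 2 * (prob p (PDEvent ends u a₂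 c) * prob p (connEvent ends a₂ b) + prob p (avoidAll ends a₂ {c}) * gap p ends u a₂ b) * prob p (TEvent ends a₂ u c) + 2 * (prob p Set.univ * prob p (PDEvent ends u a₂ c) + prob p (avoidAll ends a₂ {c}) * prob p (avoidAll ends a₂ {u})) * prob p (TEvent ends a₂ u c ∩ connEvent ends a₂ b) - 2 * (prob p Set.univ * prob p (PDEvent ends u a₂ c) + prob p (avoidAll ends a₂ {c}) * prob p (avoidAll ends a₂ {u})) * (prob p (PDEvent ends u a₂ c ∩ connEvent ends u b) + prob p (TEvent ends a₂ u c ∩ connEvent ends u b))) = 0 := by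
  have hZ := Qsplit_univ p ends u a₂ c
  have hbK := Qsplit p ends u a₂ c (connEvent ends a₂ b)
  have hbL := Qsplit p ends u a₂ c (connEvent ends u b)
  have hgap := gap_eq_Q p ends u a₂ b
  unfold Ee EQb3 PDb EQ3
  rw [hgap, hZ, hbK, hbL, prob_univ]
  ring

omit [Fintype V] [DecidableEq V] [LinearOrder R] [IsStrictOrderedRing R] in
/-- `t′·T2oK = Ee·E1K + (κ − α)·δK + 2β·B1K − 2β·B2K + P(T′,oK)·(OK)` (a `ring` identity). -/
theorem tp_mul_T2oK_eq_raw :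
    prob p (TEvent ends a₂ u c) * T2oK p ends o a₂ c b u =
      Ee p ends a₂ c b u * (prob p (TEvent ends a₂ u c) * prob p (avoidAll ends a₂ {c} ∩ connEvent ends a₂ o) - prob p (TEvent ends a₂ u c ∩ connEvent ends a₂ o) * prob p (avoidAll ends a₂ {c})) + ((prob p Set.univ * EQb3 p ends u a₂ c b + prob p Set.univ * PDb p ends u a₂ c b + prob p (connEvent ends a₂ b) * EQ3 p ends u a₂ c + prob p (connEvent ends a₂ b) * prob p (avoidAll ends a₂ {u}) - (prob p Set.univ - prob p (avoidAll ends a₂ {c})) * gap p ends u a₂ b) - (prob p (PDEvent ends u a₂ c) * prob p (connEvent ends a₂ b) + prob p (avoidAll ends a₂ {c}) * gap p ends u a₂ b)) * (prob p (TEvent ends a₂ u c) * prob p (PDEvent ends u a₂ c ∩ connEvent ends a₂ o) - prob p (PDEvent ends u a₂ c) * prob p (TEvent ends a₂ u c ∩ connEvent ends a₂ o)) + 2 * (prob p Set.univ * prob p (PDEvent ends u a₂ c) + prob p (avoidAll ends a₂ {c}) * prob p (avoidAll ends a₂ {u})) * (prob p (TEvent ends a₂ u c) * prob p (TEvent ends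 a₂ u c ∩ (connEvent ends a₂ o ∩ connEvent ends a₂ b)) - prob p (TEvent ends a₂ u c ∩ connEvent ends a₂ o) * prob p (TEvent ends a₂ u c ∩ connEvent ends a₂ b)) - 2 * (prob p Set.univ * prob p (PDEvent ends u a₂ c) + prob p (avoidAll ends a₂ {c}) * prob p (avoidAll ends a₂ {u})) * (prob p (TEvent ends a₂ u c) * (prob p (PDEvent ends u a₂ c ∩ (connEvent ends a₂ o ∩ connEvent ends u b)) + prob p (TEvent ends a₂ u c ∩ (connEvent ends a₂ o ∩ connEvent ends u b))) - prob p (TEvent ends a₂ u c ∩ connEvent ends a₂ o) * (prob p (PDEvent ends u a₂ c ∩ connEvent ends u b) + prob p (TEvent ends a₂ u c ∩ connEvent ends u b))) + prob p (TEvent ends a₂ u c ∩ connEvent ends a₂ o) * (Ee p ends a₂ c b u * prob p (avoidAll ends a₂ {c}) + ((prob p Set.univ * EQb3 p ends u a₂ c b + prob p Set.univ * PDb p ends u a₂ c b + prob p (connEvent ends a₂ b) * EQ3 p ends u a₂ c + prob p (connEvent ends a₂ b) * prob p (avoidAll ends a₂ {u}) - (prob p Set.univ - prob p (avoidAll ends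 a₂ {c})) * gap p ends u a₂ b) - (prob p (PDEvent ends u a₂ c) * prob p (connEvent ends a₂ b) + prob p (avoidAll ends a₂ {c}) * gap p ends u a₂ b)) * prob p (PDEvent ends u a₂ c) - 2 * (prob p (PDEvent ends u a₂ c) * prob p (connEvent ends a₂ b) + prob p (avoidAll ends a₂ {c}) * gap p ends u a₂ b) * prob p (TEvent ends a₂ u c) + 2 * (prob p Set.univ * prob p (PDEvent ends u a₂ c) + prob p (avoidAll ends a₂ {c}) * prob p (avoidAll ends a₂ {u})) * prob p (TEvent ends a₂ u c ∩ connEvent ends a₂ b) - 2 * (prob p Set.univ * prob p (PDEvent ends u a₂ c) + prob p (avoidAll ends a₂ {c}) * prob p (avoidAll ends a₂ {u})) * (prob p (PDEvent ends u a₂ c ∩ connEvent ends u b) + prob p (TEvent ends a₂ u c ∩ connEvent ends u b))) := by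
  unfold T2oK
  ring

omit [Fintype V] in
/-- **The master formula of the `o ∈ K` half**: `t′·T2oK = Ee·E1K + (κ − α)·δK + 2β·B1K − 2β·B2K`. -/
theorem tp_mul_T2oK_eq :
    prob p (TEvent ends a₂ u c) * T2oK p ends o a₂ c b u =
      Ee p ends a₂ c b u * (prob p (TEvent ends a₂ u c) * prob p (avoidAll ends a₂ {c} ∩ connEvent ends a₂ o) - prob p (TEvent ends a₂ u c ∩ connEvent ends a₂ o) * prob p (avoidAll ends a₂ {c})) + ((prob p Set.univ * EQb3 p ends u a₂ c b + prob p Set.univ * PDb p ends u a₂ c b + prob p (connEvent ends a₂ b) * EQ3 p ends u a₂ c + prob p (connEvent ends a₂ b) * prob p (avoidAll ends a₂ {u}) - (prob p Set.univ - prob p (avoidAll ends a₂ {c})) * gap p ends u a₂ b) - (prob p (PDEvent ends u a₂ c) * prob p (connEvent ends a₂ b) + prob p (avoidAll ends a₂ {c}) * gap p ends u a₂ b)) * (prob p (TEvent ends a₂ u c) * prob p (PDEvent ends u a₂ c ∩ connEvent ends a₂ o) - prob p (PDEvent ends u a₂ c) * prob p (TEvent ends a₂ u c ∩ connEvent ends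 a₂ o)) + 2 * (prob p Set.univ * prob p (PDEvent ends u a₂ c) + prob p (avoidAll ends a₂ {c}) * prob p (avoidAll ends a₂ {u})) * (prob p (TEvent ends a₂ u c) * prob p (TEvent ends a₂ u c ∩ (connEvent ends a₂ o ∩ connEvent ends a₂ b)) - prob p (TEvent ends a₂ u c ∩ connEvent ends a₂ o) * prob p (TEvent ends a₂ u c ∩ connEvent ends a₂ b)) - 2 * (prob p Set.univ * prob p (PDEvent ends u a₂ c) + prob p (avoidAll ends a₂ {c}) * prob p (avoidAll ends a₂ {u})) * (prob p (TEvent ends a₂ u c) * (prob p (PDEvent ends u a₂ c ∩ (connEvent ends a₂ o ∩ connEvent ends u b)) + prob p (TEvent ends a₂ u c ∩ (connEvent ends a₂ o ∩ connEvent ends u b))) - prob p (TEvent ends a₂ u c ∩ connEvent ends a₂ o) * (prob p (PDEvent ends u a₂ c ∩ connEvent ends u b) + prob p (TEvent ends a₂ u c ∩ connEvent ends u b))) := by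
  rw [tp_mul_T2oK_eq_raw, OK_eq_zero]
  ring

omit [Fintype V] in
/-- `κ − α = 2(hb·t′ − P(T′,bK)) + 2P(PD,bL) + 2P(T′,bL)`. -/
theorem kappa_sub_alpha_eq :
    ((prob p Set.univ * EQb3 p ends u a₂ c b + prob p Set.univ * PDb p ends u a₂ c b + prob p (connEvent ends a₂ b) * EQ3 p ends u a₂ c + prob p (connEvent ends a₂ b) * prob p (avoidAll ends a₂ {u}) - (prob p Set.univ - prob p (avoidAll ends a₂ {c})) * gap p ends u a₂ b) - (prob p (PDEvent ends u a₂ c) * prob p (connEvent ends a₂ b) + prob p (avoidAll ends a₂ {c}) * gap p ends u a₂ b)) = 2 * (prob p (connEvent ends a₂ b) * prob p (TEvent ends a₂ u c) - prob p (TEvent ends a₂ u c ∩ connEvent ends a₂ b)) + 2 * prob p (PDEvent ends u a₂ c ∩ connEvent ends u b) + 2 * prob p (TEvent ends a₂ u c ∩ connEvent ends u b) := by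
  have hZ := Qsplit_univ p ends u a₂ c
  have hbK := Qsplit p ends u a₂ c (connEvent ends a₂ b)
  have hbL := Qsplit p ends u a₂ c (connEvent ends u b)
  have hgap := gap_eq_Q p ends u a₂ b
  unfold EQb3 PDb EQ3
  rw [hgap, hZ, hbK, hbL, prob_univ]
  ring

/-- `0 ≤ κ − α` (the tower bound `P(T′, bK) ≤ hb·t′`). -/
theorem kappa_sub_alpha_nonneg (hp : IsProbVec p) : 0 ≤ ((prob p Set.univ * EQb3 p ends u a₂ c b + prob p Set.univ * PDb p ends u a₂ c b + prob p (connEvent ends a₂ b) * EQ3 p ends u a₂ c + prob p (connEvent ends a₂ b) * prob p (avoidAll ends a₂ {u}) - (prob p Set.univ - prob p (avoidAll ends a₂ {c})) * gap p ends u a₂ b) - (prob p (PDEvent ends u a₂ c) * prob p (connEvent ends a₂ b) + prob p (avoidAll ends a₂ {c}) * gap p ends u a₂ b)) := by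
  rw [kappa_sub_alpha_eq]
  have h := LMaster.prob_Tp_bK_le p ends a₂ c b u hp
  have n1 := prob_nonneg hp (PDEvent ends u a₂ c ∩ connEvent ends u b)
  have n2 := prob_nonneg hp (TEvent ends a₂ u c ∩ connEvent ends u b)
  nlinarith [h, n1, n2]

omit [Fintype E] [DecidableEq E] [Fintype V] [LinearOrder R] [IsStrictOrderedRing R] in
/-- `PD` is symmetric in the two roots. -/
lemma PDEvent_symm : PDEvent ends a₂ u c = PDEvent ends u a₂ c := by
  rw [ISplit.PD_eq_R_inter, ISplit.PD_eq_R_inter]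
  ext ω
  simp only [Set.mem_inter_iff, mem_avoidAll, Finset.mem_insert, Finset.mem_singleton, forall_eq_or_imp,
    forall_eq, Set.mem_compl_iff, mem_connEvent]
  constructor <;> rintro ⟨⟨h1, h2⟩, h3⟩ <;> refine ⟨⟨?_, ?_⟩, ?_⟩ <;>
    first
    | assumption
    | exact fun h => h1 (conn_symm h)

omit [Fintype E] [DecidableEq E] [Fintype V] [LinearOrder R] [IsStrictOrderedRing R] in
/-- `{u ↔ c} ∩ {a₂ ↮ {u, c}} = T′`. -/
lemma conn_inter_avoid_eq_Tp' : connEvent ends u c ∩ avoidAll ends a₂ {u, c} = TEvent ends a₂ u c := by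
  ext ω
  simp only [Set.mem_inter_iff, mem_connEvent, mem_avoidAll, Finset.mem_insert, Finset.mem_singleton,
    forall_eq_or_imp, forall_eq, TEvent, Set.mem_compl_iff]
  constructor
  · rintro ⟨h1, h2, _⟩
    exact ⟨fun h => h2 (conn_symm h), h1⟩
  · rintro ⟨h1, h2⟩
    exact ⟨h2, fun h => h1 (conn_symm h), fun h => h1 (conn_trans h2 (conn_symm h))⟩

omit [Fintype E] [DecidableEq E] [Fintype V] [LinearOrder R] [IsStrictOrderedRing R] in
/-- `{a₂ ↔ o} ∩ {u ↔ c} ∩ {a₂ ↮ {u, c}} = T′ ∩ {a₂ ↔ o}`. -/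
lemma oK_cL_avoid_eq : connEvent ends a₂ o ∩ connEvent ends u c ∩ avoidAll ends a₂ {u, c} =
    TEvent ends a₂ u c ∩ connEvent ends a₂ o := by
  rw [Set.inter_assoc, conn_inter_avoid_eq_Tp', Set.inter_comm]

omit [Fintype E] [DecidableEq E] [Fintype V] [LinearOrder R] [IsStrictOrderedRing R] in
/-- `{a₂ ↔ o} ∩ {u ↔ b} ∩ {a₂ ↮ {u, c}} = R′ ∩ ({a₂ ↔ o} ∩ {u ↔ b})`. -/
lemma oK_bL_avoid_eq : connEvent ends a₂ o ∩ connEvent ends u b ∩ avoidAll ends a₂ {u, c} =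
    avoidAll ends a₂ {u, c} ∩ (connEvent ends a₂ o ∩ connEvent ends u b) := by
  ext ω
  simp only [Set.mem_inter_iff]
  tauto

omit [Fintype V] [LinearOrder R] [IsStrictOrderedRing R] in
/-- `P(R′) = D + t′`. -/
lemma prob_Rp : prob p (PDEvent ends u a₂ c) + prob p (TEvent ends a₂ u c) = prob p (avoidAll ends a₂ {u, c}) := by
  have h := ISplit.prob_PD_add_T p ends a₂ u c Set.univ
  simp only [Set.inter_univ] at h
  rw [PDEvent_symm] at h
  exact h

omit [Fintype V] [LinearOrder R] [IsStrictOrderedRing R] in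
/-- `P(R′ ∩ X) = P(PD ∩ X) + P(T′ ∩ X)`. -/
lemma prob_Rp_inter (X : Set (Config E)) :
    prob p (PDEvent ends u a₂ c ∩ X) + prob p (TEvent ends a₂ u c ∩ X) = prob p (avoidAll ends a₂ {u, c} ∩ X) := by
  have h := ISplit.prob_PD_add_T p ends a₂ u c X
  rw [PDEvent_symm] at h
  exact h

/-- **`0 ≤ δK`** (BHK06 1.4 with `s = a₂`, `X = {u, c}`, up-sets `{o ∈ C_{a₂}}`, `{c ∈ C_u}`): `D·P(T′,oK) ≤ t′·P(PD,oK)`. -/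
theorem deltaK_nonneg (hp : IsProbVec p) : 0 ≤ (prob p (TEvent ends a₂ u c) * prob p (PDEvent ends u a₂ c ∩ connEvent ends a₂ o) - prob p (PDEvent ends u a₂ c) * prob p (TEvent ends a₂ u c ∩ connEvent ends a₂ o)) := by
  classical
  have h := bhk_cross_cluster_avoid p hp ends a₂ u (X := {u, c}) (Finset.mem_insert_self u {c})
    (isUpperSet_mem_setOf o) (isUpperSet_mem_setOf c)
  rw [← connEvent_eq_clusterInEvent ends a₂ o, ← connEvent_eq_clusterInEvent ends u c, oK_cL_avoid_eq,
    conn_inter_avoid_eq_Tp', Set.inter_comm (connEvent ends a₂ o) (avoidAll ends a₂ {u, c}),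
    ← prob_Rp_inter p ends a₂ c u (connEvent ends a₂ o), ← prob_Rp p ends a₂ c u] at h
  nlinarith [h]

/-- **`W′·B2K ≤ P(R′,bL)·δK`** (BHK06 1.4 on `R′`: `P(R′,oK,bL)·W′ ≤ P(R′,oK)·P(R′,bL)`). -/
theorem B2K_mul_W_le (hp : IsProbVec p) :
    (prob p (PDEvent ends u a₂ c) + prob p (TEvent ends a₂ u c)) * (prob p (TEvent ends a₂ u c) * (prob p (PDEvent ends u a₂ c ∩ (connEvent ends a₂ o ∩ connEvent ends u b)) + prob p (TEvent ends a₂ u c ∩ (connEvent ends a₂ o ∩ connEvent ends u b))) - prob p (TEvent ends a₂ u c ∩ connEvent ends a₂ o) * (prob p (PDEvent ends u a₂ c ∩ connEvent ends u b) + prob p (TEvent ends a₂ u c ∩ connEvent ends u b))) ≤ (prob p (PDEvent ends u a₂ c ∩ connEvent ends u b) + prob p (TEvent ends a₂ u c ∩ connEvent ends u b)) * (prob p (TEvent ends a₂ u c) * prob p (PDEvent ends u a₂ c ∩ connEvent ends a₂ o) - prob p (PDEvent ends u a₂ c) * prob p (TEvent ends a₂ u c ∩ connEvent ends a₂ o))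 := by
  classical
  have h := bhk_cross_cluster_avoid p hp ends a₂ u (X := {u, c}) (Finset.mem_insert_self u {c})
    (isUpperSet_mem_setOf o) (isUpperSet_mem_setOf b)
  rw [← connEvent_eq_clusterInEvent ends a₂ o, ← connEvent_eq_clusterInEvent ends u b, oK_bL_avoid_eq,
    Set.inter_comm (connEvent ends a₂ o) (avoidAll ends a₂ {u, c}),
    Set.inter_comm (connEvent ends u b) (avoidAll ends a₂ {u, c}),
    ← prob_Rp_inter p ends a₂ c u (connEvent ends a₂ o ∩ connEvent ends u b),
    ← prob_Rp_inter p ends a₂ c u (connEvent ends a₂ o),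
    ← prob_Rp_inter p ends a₂ c u (connEvent ends u b),
    ← prob_Rp p ends a₂ c u] at h
  have n_tp := prob_nonneg hp (TEvent ends a₂ u c)
  nlinarith [h, n_tp]

omit [Fintype E] [DecidableEq E] [Fintype V] [LinearOrder R] [IsStrictOrderedRing R] in
/-- The pointwise splitting `1_{u ∉ C_{a₂}} · 1_{a₂ ↮ c} = 1_{a₂ ↮ {u, c}}`. -/
lemma indicator_notMem_mul_avoid (ω : Config E) :
    ({W : Set V | u ∉ W}).indicator (1 : Set V → R) (cluster ends ω a₂) * (avoidAll ends a₂ {c}).indicator 1 ω =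
      (avoidAll ends a₂ {u, c}).indicator 1 ω := by
  have e : ω ∈ avoidAll ends a₂ {u, c} ↔ u ∉ cluster ends ω a₂ ∧ ω ∈ avoidAll ends a₂ {c} := by
    simp only [mem_avoidAll, Finset.mem_insert, Finset.mem_singleton, forall_eq_or_imp, forall_eq, mem_cluster]
  by_cases hu : u ∈ cluster ends ω a₂
  · rw [Set.indicator_of_notMem (show cluster ends ω a₂ ∉ {W : Set V | u ∉ W} from fun h => h hu),
      Set.indicator_of_notMem (show ω ∉ avoidAll ends a₂ {u, c} from fun h => (e.1 h).1 hu)]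
    simp
  · rw [Set.indicator_of_mem (show cluster ends ω a₂ ∈ {W : Set V | u ∉ W} from hu)]
    by_cases hc : ω ∈ avoidAll ends a₂ {c}
    · rw [Set.indicator_of_mem hc, Set.indicator_of_mem (e.2 ⟨hu, hc⟩)]
      simp
    · rw [Set.indicator_of_notMem hc, Set.indicator_of_notMem (show ω ∉ avoidAll ends a₂ {u, c} from fun h => hc (e.1 h).2)]
      simp

/-- **`0 ≤ E1K`**: `P(T′,oK)·d0 ≤ t′·e0` — explore `K = C_{a₂}` on `{a₂ ↮ c}`; with `g(K) = P_{G∖K}(c ∈ C_u)` the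
functionals `F₁ = 1_{o ∈ K}` and `F₂ = 1 − 1_{u ∉ K}·g(K)` are nonnegative and increasing, and the functional
same-cluster inequality `bhk_induced` (`X = Y = {c}`) gives `e0·(d0 − t′) ≤ (e0 − P(T′,oK))·d0`. -/
theorem E1K_nonneg (hp : IsProbVec p) : 0 ≤ (prob p (TEvent ends a₂ u c) * prob p (avoidAll ends a₂ {c} ∩ connEvent ends a₂ o) - prob p (TEvent ends a₂ u c ∩ connEvent ends a₂ o) * prob p (avoidAll ends a₂ {c})) := by
  classical
  set g := delClusterProb p ends u {W : Set V | c ∈ W} with hg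
  have hg_anti : Antitone g := delClusterProb_anti p hp ends u (isUpperSet_mem_setOf c)
  have hg0 : ∀ W, 0 ≤ g W := delClusterProb_nonneg p hp ends u _
  have hg1 : ∀ W, g W ≤ 1 := delClusterProb_le_one p hp ends u _
  -- the exploration identities on `{a₂ ↮ {u, c}}`
  have eT := prob_clusterIn_inter_avoid_eq_expect p ends a₂ u (X := {u, c}) (Finset.mem_insert_self u {c})
    Set.univ {W : Set V | c ∈ W}
  simp only [Set.indicator_univ, Pi.one_apply, one_mul] at eT
  have eT' : clusterInEvent ends a₂ Set.univ ∩ clusterInEvent ends u {W : Set V | c ∈ W} ∩ avoidAll ends a₂ {u, c} =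
      TEvent ends a₂ u c := by
    have : clusterInEvent ends a₂ Set.univ ∩ clusterInEvent ends u {W : Set V | c ∈ W} ∩ avoidAll ends a₂ {u, c} =
        clusterInEvent ends u {W : Set V | c ∈ W} ∩ avoidAll ends a₂ {u, c} := by
      ext ω; simp [clusterInEvent]
    rw [this, ← connEvent_eq_clusterInEvent ends u c, conn_inter_avoid_eq_Tp']
  rw [eT'] at eT
  have eTo := prob_clusterIn_inter_avoid_eq_expect p ends a₂ u (X := {u, c}) (Finset.mem_insert_self u {c})
    {W : Set V | o ∈ W} {W : Set V | c ∈ W}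
  rw [← connEvent_eq_clusterInEvent ends a₂ o, ← connEvent_eq_clusterInEvent ends u c, oK_cL_avoid_eq] at eTo
  have e0e : prob p (avoidAll ends a₂ {c} ∩ connEvent ends a₂ o) = expect p (fun ω => ({W : Set V | o ∈ W}).indicator (1 : Set V → R) (cluster ends ω a₂) *
      (avoidAll ends a₂ {c}).indicator 1 ω) := by
    rw [Set.inter_comm, connEvent_eq_clusterInEvent ends a₂ o]
    exact prob_clusterInEvent_inter_eq_expect p ends a₂ _ _
  have d0e : prob p (avoidAll ends a₂ {c}) = expect p (fun ω => (avoidAll ends a₂ {c}).indicator 1 ω) := prob_eq_expect_indicator p _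
  -- the functional same-cluster inequality with `F₁ = 1_{o ∈ ·}`, `F₂ = 1 − 1_{u ∉ ·} · g`, `X = Y = {c}`
  have hF₁ : Monotone (({W : Set V | o ∈ W}).indicator (1 : Set V → R)) :=
    monotone_indicator_one_of_isUpperSet (isUpperSet_mem_setOf o)
  have hF₂ : Monotone (fun W => 1 - ({W : Set V | u ∉ W}).indicator (1 : Set V → R) W * g W) := by
    intro W W' h
    beta_reduce
    by_cases hu' : u ∈ W'
    · rw [Set.indicator_of_notMem (show W' ∉ {W : Set V | u ∉ W} from fun h' => h' hu')]
      have : 0 ≤ ({W : Set V | u ∉ W}).indicator (1 : Set V → R) W * g W :=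
        mul_nonneg (Set.indicator_apply_nonneg fun _ => zero_le_one) (hg0 W)
      linarith
    · have hu : u ∉ W := fun h' => hu' (h h')
      rw [Set.indicator_of_mem (show W' ∈ {W : Set V | u ∉ W} from hu'),
        Set.indicator_of_mem (show W ∈ {W : Set V | u ∉ W} from hu)]
      simp only [Pi.one_apply, one_mul]
      linarith [hg_anti h]
  have hF₁0 : ∀ W, 0 ≤ ({W : Set V | o ∈ W}).indicator (1 : Set V → R) W :=
    fun W => Set.indicator_apply_nonneg fun _ => zero_le_one
  have hF₂0 : ∀ W, 0 ≤ 1 - ({W : Set V | u ∉ W}).indicator (1 : Set V → R) W * g W := by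
    intro W
    have h1 : ({W : Set V | u ∉ W}).indicator (1 : Set V → R) W ≤ 1 := Set.indicator_apply_le' (fun _ => le_rfl) (fun _ => zero_le_one)
    have h0 : 0 ≤ ({W : Set V | u ∉ W}).indicator (1 : Set V → R) W := Set.indicator_apply_nonneg fun _ => zero_le_one
    nlinarith [hg0 W, hg1 W, h1, h0]
  have key := bhk_induced p hp ends a₂ hF₁ hF₂ hF₁0 hF₂0 Finset.univ {c} {c} (Finset.subset_univ _)
    (Finset.subset_univ _)
  simp only [Finset.inter_self, Finset.union_self, REvent_univ] at key
  have e : ∀ F : Set V → R, clusterObs ends Finset.univ a₂ F * (avoidAll ends a₂ {c}).indicator 1 =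
      fun ω => F (cluster ends ω a₂) * (avoidAll ends a₂ {c}).indicator 1 ω := by
    intro F
    funext ω
    simp only [Pi.mul_apply, clusterObs_apply, clusterIn_univ]
  rw [e, e, e] at key
  simp only [Pi.mul_apply] at key
  -- the three expectations in the masses
  have eA : expect p (fun ω => ({W : Set V | o ∈ W}).indicator (1 : Set V → R) (cluster ends ω a₂) *
      (avoidAll ends a₂ {c}).indicator 1 ω) = prob p (avoidAll ends a₂ {c} ∩ connEvent ends a₂ o) := e0e.symm
  have eB : expect p (fun ω => (1 - ({W : Set V | u ∉ W}).indicator (1 : Set V → R) (cluster ends ω a₂) *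
      g (cluster ends ω a₂)) * (avoidAll ends a₂ {c}).indicator 1 ω) = prob p (avoidAll ends a₂ {c}) - prob p (TEvent ends a₂ u c) := by
    rw [eT, d0e, ← expect_sub]
    congr 1
    funext ω
    simp only [Pi.sub_apply]
    have hsplit : ({W : Set V | u ∉ W}).indicator (1 : Set V → R) (cluster ends ω a₂) *
        (avoidAll ends a₂ {c}).indicator 1 ω = (avoidAll ends a₂ {u, c}).indicator 1 ω :=
      indicator_notMem_mul_avoid ends a₂ c u ω
    linear_combination (-(g (cluster ends ω a₂))) * hsplit
  have eC : expect p (fun ω => ({W : Set V | o ∈ W}).indicator (1 : Set V → R) (cluster ends ω a₂) *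
      (1 - ({W : Set V | u ∉ W}).indicator (1 : Set V → R) (cluster ends ω a₂) * g (cluster ends ω a₂)) *
      (avoidAll ends a₂ {c}).indicator 1 ω) = prob p (avoidAll ends a₂ {c} ∩ connEvent ends a₂ o) - prob p (TEvent ends a₂ u c ∩ connEvent ends a₂ o) := by
    rw [eTo, ← eA, ← expect_sub]
    congr 1
    funext ω
    simp only [Pi.sub_apply]
    have hsplit : ({W : Set V | u ∉ W}).indicator (1 : Set V → R) (cluster ends ω a₂) *
        (avoidAll ends a₂ {c}).indicator 1 ω = (avoidAll ends a₂ {u, c}).indicator 1 ω :=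
      indicator_notMem_mul_avoid ends a₂ c u ω
    linear_combination (-(({W : Set V | o ∈ W}).indicator (1 : Set V → R) (cluster ends ω a₂) * g (cluster ends ω a₂))) * hsplit
  rw [eA, eB, eC] at key
  nlinarith [key]

omit [Fintype V] in
/-- `W′·t′·T2oK = C2 + 2β·(P(R′,bL)·δK − W′·B2K)` (a `ring` identity on top of the master formula). -/
theorem W_mul_tp_mul_T2oK_eq :
    (prob p (PDEvent ends u a₂ c) + prob p (TEvent ends a₂ u c)) * prob p (TEvent ends a₂ u c) * T2oK p ends o a₂ c b u =
      (Ee p ends a₂ c b u * (prob p (PDEvent ends u a₂ c) + prob p (TEvent ends a₂ u c)) * (prob p (TEvent ends a₂ u c) * prob p (avoidAll ends a₂ {c} ∩ connEvent ends a₂ o) - prob p (TEvent ends a₂ u c ∩ connEvent ends a₂ o) * prob p (avoidAll ends a₂ {c})) + (prob p (TEvent ends a₂ u c) * prob p (PDEvent ends u a₂ c ∩ connEvent ends a₂ o) - prob p (PDEvent ends u a₂ c) * prob p (TEvent ends a₂ u c ∩ connEvent ends a₂ o)) * ((prob p (PDEvent ends u a₂ c) + prob p (TEvent ends a₂ u c))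 * ((prob p Set.univ * EQb3 p ends u a₂ c b + prob p Set.univ * PDb p ends u a₂ c b + prob p (connEvent ends a₂ b) * EQ3 p ends u a₂ c + prob p (connEvent ends a₂ b) * prob p (avoidAll ends a₂ {u}) - (prob p Set.univ - prob p (avoidAll ends a₂ {c})) * gap p ends u a₂ b) - (prob p (PDEvent ends u a₂ c) * prob p (connEvent ends a₂ b) + prob p (avoidAll ends a₂ {c}) * gap p ends u a₂ b)) - 2 * (prob p Set.univ * prob p (PDEvent ends u a₂ c) + prob p (avoidAll ends a₂ {c}) * prob p (avoidAll ends a₂ {u})) * (prob p (PDEvent ends u a₂ c ∩ connEvent ends u b) + prob p (TEvent ends a₂ u c ∩ connEvent ends u b))) + 2 * (prob p Set.univ * prob p (PDEvent ends u a₂ c) + prob p (avoidAll ends a₂ {c}) * prob p (avoidAll ends a₂ {u})) * (prob p (PDEvent ends u a₂ c) + prob p (TEvent ends a₂ u c)) * (prob p (TEvent ends a₂ u c) * prob p (TEvent ends a₂ u c ∩ (connEvent ends a₂ o ∩ connEvent ends a₂ b)) - prob p (TEvent ends a₂ u c ∩ connEvent ends a₂ o) * prob p (TEvent ends a₂ u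 c ∩ connEvent ends a₂ b))) + 2 * (prob p Set.univ * prob p (PDEvent ends u a₂ c) + prob p (avoidAll ends a₂ {c}) * prob p (avoidAll ends a₂ {u})) * ((prob p (PDEvent ends u a₂ c ∩ connEvent ends u b) + prob p (TEvent ends a₂ u c ∩ connEvent ends u b)) * (prob p (TEvent ends a₂ u c) * prob p (PDEvent ends u a₂ c ∩ connEvent ends a₂ o) - prob p (PDEvent ends u a₂ c) * prob p (TEvent ends a₂ u c ∩ connEvent ends a₂ o)) - (prob p (PDEvent ends u a₂ c) + prob p (TEvent ends a₂ u c)) * (prob p (TEvent ends a₂ u c) * (prob p (PDEvent ends u a₂ c ∩ (connEvent ends a₂ o ∩ connEvent ends u b)) + prob p (TEvent ends a₂ u c ∩ (connEvent ends a₂ o ∩ connEvent ends u b))) - prob p (TEvent ends a₂ u c ∩ connEvent ends a₂ o) * (prob p (PDEvent ends u a₂ c ∩ connEvent ends u b) + prob p (TEvent ends a₂ u c ∩ connEvent ends u b)))) := by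
  have h := tp_mul_T2oK_eq p ends o a₂ c b u
  linear_combination (prob p (PDEvent ends u a₂ c) + prob p (TEvent ends a₂ u c)) * h

/-- **`0 ≤ T2oK` on every instance with `C2 ≥ 0` and `C3 ≥ 0`** — the reduction of the `o ∈ K` half to the two
whole-instance claims `C2 = Ee·W′·E1K + δK·(W′·(κ − α) − 2β·P(R′,bL)) + 2β·W′·B1K ≥ 0` and
`C3 = Ee·e0 + (κ − α)·P(PD,oK) − 2β·P(PD,oK,bL) ≥ 0`. -/
theorem T2oK_nonneg_of_C2_C3 (hp : IsProbVec p) (hC2 : 0 ≤ (Ee p ends a₂ c b u * (prob p (PDEvent ends u a₂ c) + prob p (TEvent ends a₂ u c)) * (prob p (TEvent ends a₂ u c) * prob p (avoidAll ends a₂ {c} ∩ connEvent ends a₂ o) - prob p (TEvent ends a₂ u c ∩ connEvent ends a₂ o) * prob p (avoidAll ends a₂ {c})) + (prob p (TEvent ends a₂ u c) * prob p (PDEvent ends u a₂ c ∩ connEvent ends a₂ o) - prob p (PDEvent ends u a₂ c) * prob p (TEvent ends a₂ u c ∩ connEvent ends a₂ o)) * ((prob p (PDEvent ends u a₂ c)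 + prob p (TEvent ends a₂ u c)) * ((prob p Set.univ * EQb3 p ends u a₂ c b + prob p Set.univ * PDb p ends u a₂ c b + prob p (connEvent ends a₂ b) * EQ3 p ends u a₂ c + prob p (connEvent ends a₂ b) * prob p (avoidAll ends a₂ {u}) - (prob p Set.univ - prob p (avoidAll ends a₂ {c})) * gap p ends u a₂ b) - (prob p (PDEvent ends u a₂ c) * prob p (connEvent ends a₂ b) + prob p (avoidAll ends a₂ {c}) * gap p ends u a₂ b)) - 2 * (prob p Set.univ * prob p (PDEvent ends u a₂ c) + prob p (avoidAll ends a₂ {c}) * prob p (avoidAll ends a₂ {u})) * (prob p (PDEvent ends u a₂ c ∩ connEvent ends u b) + prob p (TEvent ends a₂ u c ∩ connEvent ends u b))) + 2 * (prob p Set.univ * prob p (PDEvent ends u a₂ c) + prob p (avoidAll ends a₂ {c}) * prob p (avoidAll ends a₂ {u})) * (prob p (PDEvent ends u a₂ c) + prob p (TEvent ends a₂ u c)) * (prob p (TEvent ends a₂ u c) * prob p (TEvent ends a₂ u c ∩ (connEvent ends a₂ o ∩ connEvent ends a₂ b)) - prob p (TEvent ends a₂ u c ∩ connEvent ends a₂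 o) * prob p (TEvent ends a₂ u c ∩ connEvent ends a₂ b)))) (hC3 : 0 ≤ (Ee p ends a₂ c b u * prob p (avoidAll ends a₂ {c} ∩ connEvent ends a₂ o) + ((prob p Set.univ * EQb3 p ends u a₂ c b + prob p Set.univ * PDb p ends u a₂ c b + prob p (connEvent ends a₂ b) * EQ3 p ends u a₂ c + prob p (connEvent ends a₂ b) * prob p (avoidAll ends a₂ {u}) - (prob p Set.univ - prob p (avoidAll ends a₂ {c})) * gap p ends u a₂ b) - (prob p (PDEvent ends u a₂ c) * prob p (connEvent ends a₂ b) + prob p (avoidAll ends a₂ {c}) * gap p ends u a₂ b)) * prob p (PDEvent ends u a₂ c ∩ connEvent ends a₂ o) - 2 * (prob p Set.univ * prob p (PDEvent ends u a₂ c) + prob p (avoidAll ends a₂ {c}) * prob p (avoidAll ends a₂ {u})) * prob p (PDEvent ends u a₂ c ∩ (connEvent ends a₂ o ∩ connEvent ends u b)))) :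
    0 ≤ T2oK p ends o a₂ c b u := by
  classical
  have n_tp := prob_nonneg hp (TEvent ends a₂ u c)
  have n_D := prob_nonneg hp (PDEvent ends u a₂ c)
  have n_d0 := prob_nonneg hp (avoidAll ends a₂ {c})
  have n_Z := prob_nonneg hp (avoidAll ends a₂ {u})
  have n_β : 0 ≤ (prob p Set.univ * prob p (PDEvent ends u a₂ c) + prob p (avoidAll ends a₂ {c}) * prob p (avoidAll ends a₂ {u})) := by
    rw [prob_univ]
    nlinarith [mul_nonneg n_d0 n_Z]
  rcases eq_or_lt_of_le n_tp with ht0 | htpos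
  · -- `t′ = 0`: the `T′`-masses vanish and `T2oK = C3`
    have h1 : prob p (TEvent ends a₂ u c ∩ connEvent ends a₂ o) = 0 :=
      le_antisymm (ht0 ▸ prob_mono hp Set.inter_subset_left) (prob_nonneg hp _)
    have h2 : prob p (TEvent ends a₂ u c ∩ (connEvent ends a₂ o ∩ connEvent ends a₂ b)) = 0 :=
      le_antisymm (ht0 ▸ prob_mono hp Set.inter_subset_left) (prob_nonneg hp _)
    have h3 : prob p (TEvent ends a₂ u c ∩ (connEvent ends a₂ o ∩ connEvent ends u b)) = 0 :=
      le_antisymm (ht0 ▸ prob_mono hp Set.inter_subset_left) (prob_nonneg hp _)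
    unfold T2oK
    rw [h1, h2, h3]
    simp only [sub_zero, mul_zero, add_zero]
    exact hC3
  · have hW : 0 < (prob p (PDEvent ends u a₂ c) + prob p (TEvent ends a₂ u c)) := by linarith
    have hδ := deltaK_nonneg p ends o a₂ c u hp
    have hB2 := B2K_mul_W_le p ends o a₂ c b u hp
    have n_RbL := prob_nonneg hp (PDEvent ends u a₂ c ∩ connEvent ends u b)
    have n_TbL := prob_nonneg hp (TEvent ends a₂ u c ∩ connEvent ends u b)
    have key := W_mul_tp_mul_T2oK_eq p ends o a₂ c b u
    have hpos : 0 ≤ (prob p (PDEvent ends u a₂ c) + prob p (TEvent ends a₂ u c)) * prob p (TEvent ends a₂ u c) * T2oK p ends o a₂ c b u := by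
      rw [key]
      have : 0 ≤ 2 * (prob p Set.univ * prob p (PDEvent ends u a₂ c) + prob p (avoidAll ends a₂ {c}) * prob p (avoidAll ends a₂ {u})) * ((prob p (PDEvent ends u a₂ c ∩ connEvent ends u b) + prob p (TEvent ends a₂ u c ∩ connEvent ends u b)) * (prob p (TEvent ends a₂ u c) * prob p (PDEvent ends u a₂ c ∩ connEvent ends a₂ o) - prob p (PDEvent ends u a₂ c) * prob p (TEvent ends a₂ u c ∩ connEvent ends a₂ o)) - (prob p (PDEvent ends u a₂ c) + prob p (TEvent ends a₂ u c)) * (prob p (TEvent ends a₂ u c) * (prob p (PDEvent ends u a₂ c ∩ (connEvent ends a₂ o ∩ connEvent ends u b)) + prob p (TEvent ends a₂ u c ∩ (connEvent ends a₂ o ∩ connEvent ends u b))) - prob p (TEvent ends a₂ u c ∩ connEvent ends a₂ o) * (prob p (PDEvent ends u a₂ c ∩ connEvent ends u b) + prob p (TEvent ends a₂ u c ∩ connEvent ends u b)))) :=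
        mul_nonneg (mul_nonneg (by norm_num) n_β) (by linarith)
      linarith
    by_contra hneg
    have := mul_neg_of_pos_of_neg (mul_pos hW htpos) (not_le.mp hneg)
    linarith

end KMaster

end RootLeafU

end Summit.Ventures.PercRepro2
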